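import Summits.CriticalPhenomena.PercolationContinuityZ3.Theorems.FK.Transplant.KNFreeSlabPooling
import HarnessLib

/-!
# FRONTIER TRANSPLANT, binder 2 (TP_FK) — T4-SLAB (S2): the slab Step IV at ONE CONTACT — sub-plates + lanes ⇒ F2's Step-IV
# hypothesis `hIV` for the gated collar of width `2L+1`, via the lane ROUTER (outer cases O1/O23, inner cases X/T4/Y-column)

Support file (`--supports stmt-CriticalPhenomena-4575`, helper) of the FRONTIER TRANSPLANT sub-cell (`fk-continuity/transplant/`,
seat `prim-bschramm-fkt-p1`); builds on p205010 (kernel theorem, internal audit signed; external expert review pending).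
0 definitions · 0 named facts · 0 sorries · standard axioms. File 15/18 of the bytes-first package (R60 (3)(β)) of the
UNFUNDED memo row `T4-SLAB [g122, R60]` (re-described R62 (E)); proposable only on a coordinator ruling.
Registered R63 (cell INBOX l.4709, 2026-08-23); registry row T4s; lead label T4s-15 (fkt-lead L22, l.4677).

HONEST FRAMING (page 1, cell rule). The transplant's theorem of record `ufsc0_of_freeBoundaryHypothesis_r3` (p248245) is
CONDITIONAL on FH AND on TP_FK = `KNFreeTargetHittable d q p`, both OPEN at the same `p` for `q > 1` near `p_c(q)` (⇔ GRC Conj.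
(5.103) via K1; barrier note `Literature.Barriers.CriticalPhenomena.SamePFreeBoundaryCriteria`, FBN-01, cited first); the
transplant is a typed reduction, not a proof of FK continuity. THIS FILE assembles the slab Step IV at one contact window `(i, σ, y)` of a level box `Icc Lo Hi ⊆ D`:
`slabStepIV_of_lanes` (sub-plates + a lane for every exit ⇒ the Step-IV inequality; constants `n, n′, M₀, Pbig, N_P`),
`fat_of_not_ext` (outside the outer cases the level box is fat next to the look box), and `slabStepIV_contact` — the
ROUTER: outer lanes (`outer_lane`) when the look-box geometry is in case O1/O23, inner lanes (`inner_lane`, gates from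
`exists_gate_foot`) otherwise; conclusion = the hypothesis `hIV` of F2's `stepV_in_fkLaw` at the contact, for the free
thin-shell law of the GATED COLLAR of width `2L+1` and a look box `v + ℓQ_g ⊆ D` of a centred box geometry `g` with
far set in the target, with the uniform bound `γ`. It proves nothing about either binder and says nothing at `p ↓ p_c(q)`; NOT `_r4`; `_r3` « 2 / 0 ☑ », n_open = 2,
BINDER-OWNERS, FO-19 NO-GO unchanged.

Declarations: `slabStepIV_of_lanes`, `fat_of_not_ext`, `slabStepIV_contact`.

References: G. Kozma, S. Nitzan, arXiv:2401.12397 (2024), §4 Lemma 7, Lemma 10 Step IV (pp. 19–21) [KozmaNitzan2024];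
G. Grimmett, *The Random-Cluster Model*, Springer 2006, Thm. (3.7), Thm. (3.8), Thm. (3.21) eq. (3.22), Lemma (4.13), §5.7 [Grimmett2006].
-/

noncomputable section

namespace Summit.CriticalPhenomena.PercolationContinuityZ3.Theorems.FK

open MeasureTheory
open scoped ENNReal Classical
open Literature.Probability.Percolation Literature.Probability.LatticeModels SimpleGraph
open Literature.Probability.Percolation.KozmaNitzan Transplant Literature.Barriers.CriticalPhenomena

variable {d : ℕ}

set_option maxHeartbeats 400000 in
/-- **Slab Step IV from lanes.** For a contact window `(i, σ, y)` of the level box `Icc Lo Hi ⊆ D` (cube centre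
`v`), the frozen set `S` = the gated collar of width `2L+1`, a look box `U = v + ℓQ_g ⊆ D` with far set in `Tgt`, a lane
direction `c ∉ {i, a}` with `F` extending on the side `s` of `v_c`, and an exit layer `zi` of the collar: IF every exit
`z` (on layer `zi`, `z_c = ζ` in the central window on the side `s`, transversally within `M₀` of `v`) admits a lane
(`t ∈ v + ℓF_g`, `w`, `γ ≤ φ^free_R(z ↔ t in R)`), THEN the hypothesis `hIV` of `stepV_in_fkLaw` holds at this
contact: `1 - 3δ ≤ φ_{free S}{ξ | ∃ u ∈ U(x), φ_ξ(u ↔ Tgt in D) > 1 - δ}`.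
[cite: KozmaNitzan2024, §4 Lemma 10 Step IV (pp. 19–21); Grimmett2006, §5.7, Thm. (3.7), Thm. (3.8), eq. (3.22)] -/
theorem slabStepIV_of_lanes {q : ℝ} (hq : 1 ≤ q) (p : unitInterval) (hd : 3 ≤ d) {L : ℕ}
    {β : ℝ}
    (hβ : ∀ (N : ℕ) (g : zdGraph d ≃g zdGraph d) (u z : Site d), u ∈ fkSlab d L N → z ∈ fkSlab d L N →
      β ≤ (fkLaw ((fkSlab d L N).image g) (restrW (↑((fkSlab d L N).image g) : Set (Site d)) (lattW d p)) q).real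
        (openConnIn (↑((fkSlab d L N).image g) : Set (Site d)) (g u) (g z)))
    (Λ : Finset (Site d)) (W : Sym2 (Site d) → unitInterval) (D : Finset (Site d)) (hsub : IsSubbox W p D) (hDΛ : D ⊆ Λ)
    (Lo Hi : Site d) (hXD : Finset.Icc Lo Hi ⊆ D) (M : ℕ) (i : Fin d) (σ : ℤ) (y : Site d) (h : WinHyp Lo Hi M i σ y)
    (hwidei : Lo i + 4 * (M : ℤ) + 4 ≤ Hi i)
    (Pg Pbig N_P n n' Pl M₀ : ℕ) (g₀ : ℤ) (hP : Pbig = 2 * N_P + 3) (hn : 0 < n) (hnPl : n * Pl ≤ N_P) (hPl : 2 * L + 1 ≤ Pl)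
    (hLN_P : L ≤ N_P) (hM₀c : ((n' : ℤ) + 2) * Pbig ≤ M₀) (hPM₀ : Pbig ≤ M₀) (hM : M₀ + N_P + 2 * L + 1 ≤ M)
    (ℓ : ℕ) (hM₀ℓ : (M₀ : ℤ) + L ≤ ℓ) (g : Geom d) (a : Fin d) (hF0 : ∀ b, b ≠ a → g.loF b ≤ 0 ∧ 0 ≤ g.hiF b)
    (c : Fin d) (hci : c ≠ i) (hca : c ≠ a) (s : ℤ) (hs : s = 1 ∨ s = -1)
    (hsF : (s = 1 → 1 ≤ g.hiF c) ∧ (s = -1 → g.loF c ≤ -1))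
    (hQD : g.Qset ℓ (vctr Lo Hi M i σ y) ⊆ D) (Tgt : Finset (Site d)) (hFT : g.Fset ℓ (vctr Lo Hi M i σ y) ⊆ Tgt)
    (zi : ℤ) (hzi : |zi - (y i - σ * ((L : ℤ) + 1))| ≤ (L : ℤ))
    {γ δ : ℝ} (hγ0 : 0 ≤ γ) (hγ1 : γ ≤ 1) (hδn' : (1 - β / 2) ^ n' ≤ 3 * δ) (hK : (1 - γ) ^ ⌈β * n / 2⌉₊ < δ)
    (hlane : ∀ (ζ : ℤ) (z : Site d), z i = zi → z c = ζ → (∀ b, b ≠ i → |z b - vctr Lo Hi M i σ y b| ≤ M₀) →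
      (vctr Lo Hi M i σ y c + ℓ * g.loF c ≤ ζ - L ∧ ζ + L ≤ vctr Lo Hi M i σ y c + ℓ * g.hiF c) →
      |ζ - vctr Lo Hi M i σ y c| ≤ M₀ →
      ∃ t w : Site d, t ∈ g.Fset ℓ (vctr Lo Hi M i σ y) ∧ (z = w ∨ ¬ (zdGraph d).Adj z w) ∧
        γ ≤ (fkLaw (((g.Qset ℓ (vctr Lo Hi M i σ y)).filter fun x => |x c - ζ| ≤ (L : ℤ)) \
            ((((Finset.Icc (Lo + 1) (Hi - 1) \ Finset.Icc (Lo + (((2 * L + 1 : ℕ) : Site d) + 1))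
              (Hi - (((2 * L + 1 : ℕ) : Site d) + 1))).filter fun x => ¬ slabGate Lo Hi (2 * L + 1) Pg Pbig g₀ x)) \ {z, w}))
          (restrW (↑(((g.Qset ℓ (vctr Lo Hi M i σ y)).filter fun x => |x c - ζ| ≤ (L : ℤ)) \
            ((((Finset.Icc (Lo + 1) (Hi - 1) \ Finset.Icc (Lo + (((2 * L + 1 : ℕ) : Site d) + 1))
              (Hi - (((2 * L + 1 : ℕ) : Site d) + 1))).filter fun x => ¬ slabGate Lo Hi (2 * L + 1) Pg Pbig g₀ x)) \ {z, w})) :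
              Set (Site d)) (lattW d p)) q).real
          (openConnIn (↑(((g.Qset ℓ (vctr Lo Hi M i σ y)).filter fun x => |x c - ζ| ≤ (L : ℤ)) \
            ((((Finset.Icc (Lo + 1) (Hi - 1) \ Finset.Icc (Lo + (((2 * L + 1 : ℕ) : Site d) + 1))
              (Hi - (((2 * L + 1 : ℕ) : Site d) + 1))).filter fun x => ¬ slabGate Lo Hi (2 * L + 1) Pg Pbig g₀ x)) \ {z, w})) :
              Set (Site d)) z t)) :
    1 - 3 * δ ≤ (fkLaw Λ (restrW (↑(((Finset.Icc (Lo + 1) (Hi - 1) \ Finset.Icc (Lo + (((2 * L + 1 : ℕ) : Site d) + 1))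
        (Hi - (((2 * L + 1 : ℕ) : Site d) + 1))).filter fun x => ¬ slabGate Lo Hi (2 * L + 1) Pg Pbig g₀ x)) : Set (Site d)) W) q).real
      {ξ | ∃ u ∈ uface Lo Hi M i σ y, 1 - δ < (fkLaw Λ (pinW W (wireSet (↑(((Finset.Icc (Lo + 1) (Hi - 1) \
        Finset.Icc (Lo + (((2 * L + 1 : ℕ) : Site d) + 1)) (Hi - (((2 * L + 1 : ℕ) : Site d) + 1))).filter
          fun x => ¬ slabGate Lo Hi (2 * L + 1) Pg Pbig g₀ x)) : Set (Site d))) ξ) q).real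
        (⋃ t ∈ Tgt, openConnIn (↑D : Set (Site d)) u t)} := by
  have hd2 : 2 ≤ d := by omega
  set v := vctr Lo Hi M i σ y with hv
  set S := ((Finset.Icc (Lo + 1) (Hi - 1) \ Finset.Icc (Lo + (((2 * L + 1 : ℕ) : Site d) + 1))
    (Hi - (((2 * L + 1 : ℕ) : Site d) + 1))).filter fun x => ¬ slabGate Lo Hi (2 * L + 1) Pg Pbig g₀ x) with hSdef
  have hSsub : S ⊆ Finset.Icc (Lo + 1) (Hi - 1) := gatedCollar_subset Lo Hi (2 * L + 1) Pg Pbig g₀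
  have hSD : S ⊆ D := hSsub.trans ((Finset.Icc_subset_Icc (by intro k; simp) (by intro k; simp)).trans hXD)
  have hℓ0 : (0 : ℤ) ≤ ℓ := Nat.cast_nonneg ℓ
  have hL0 : (0 : ℤ) ≤ L := Nat.cast_nonneg L
  -- the two long directions of the sub-plates and the coordinate permutation; the centres
  obtain ⟨e, hei, hec⟩ := Fin.exists_ne_and_ne_of_two_lt i c hd
  obtain ⟨π, hπc, hπe⟩ := exists_perm_long_eq hd2 (Ne.symm hec)
  obtain ⟨ctr, hctr⟩ := exists_subplate_centres i c hci σ s hs y v L N_P Pbig n' M₀ hP hM₀c g₀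
  -- per sub-plate facts
  have hone : ∀ j < n', _ := fun j hj =>
    one_subplate hd Lo Hi M i σ y h hwidei Pg Pbig N_P n Pl M₀ g₀ hP hnPl hPl hLN_P hPM₀ hM c e hci hei hec π hπc hπe
      s hs zi hzi (ctr j) (hctr j hj).1 (hctr j hj).2.1 (hctr j hj).2.2.1 (hctr j hj).2.2.2.2
  refine slab_pooling hq p Λ W D hsub hDΛ S hSD (g.Qset ℓ v) hQD Tgt (uface Lo Hi M i σ y) L c hn
    (fun j => (fkSlab d L N_P).image (fun q => Site.signedPerm π 1 q + ctr j))
    (fun j => Function.update (ctr j) i (y i - σ))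
    (fun j k => Function.update (Function.update (ctr j) i zi) c (ctr j c + s * k * Pl))
    (fun j hj => (hone j hj).1)
    (fun j₁ h₁ j₂ h₂ hne => disjoint_subplates hd2 c e π hπc hπe (ctr j₁) (ctr j₂) ((hctr j₁ h₁).2.2.2.1 j₂ h₂ (Ne.symm hne)))
    (fun j hj => (hone j hj).2.1)
    (fun j hj k hk => le_fkLaw_image_real_openConnIn_of_mem p hβ π (ctr j) (hone j hj).2.2.1 ((hone j hj).2.2.2.1 k hk))
    (fun j hj k₁ hk₁ k₂ hk₂ hne => by
      rw [Function.update_self, Function.update_self]; exact (hone j hj).2.2.2.2.1 k₁ hk₁ k₂ hk₂ hne)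
    (fun j hj k hk => ?_) hγ0 hγ1 hδn' hK
  -- the lane of the exit `(j, k)`
  obtain ⟨hzb, hζv⟩ := (hone j hj).2.2.2.2.2 k hk
  have hc1 := (hctr j hj).2.1
  have hζI : v c + ℓ * g.loF c ≤ ctr j c + s * k * Pl - L ∧ ctr j c + s * k * Pl + L ≤ v c + ℓ * g.hiF c := by
    have hF0c := hF0 c hca
    have hl0 : (ℓ : ℤ) * g.loF c ≤ 0 := mul_nonpos_of_nonneg_of_nonpos hℓ0 hF0c.1
    have hh0 : 0 ≤ (ℓ : ℤ) * g.hiF c := mul_nonneg hℓ0 hF0c.2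
    have hkPl : (0 : ℤ) ≤ (k : ℤ) * Pl := by positivity
    have hLN' : (L : ℤ) ≤ N_P := by exact_mod_cast hLN_P
    rw [abs_le] at hζv
    rcases hs with h1 | h1
    · have h2 : (ℓ : ℤ) ≤ ℓ * g.hiF c := by have := mul_le_mul_of_nonneg_left (hsF.1 h1) hℓ0; linarith
      rw [h1] at hc1 hζv ⊢; constructor <;> nlinarith [hc1.1, hc1.2, hζv.1, hζv.2]
    · have h2 : (ℓ : ℤ) * g.loF c ≤ -ℓ := by have := mul_le_mul_of_nonneg_left (hsF.2 h1) hℓ0; linarith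
      rw [h1] at hc1 hζv ⊢; constructor <;> nlinarith [hc1.1, hc1.2, hζv.1, hζv.2]
  obtain ⟨t, w, htF, hzw, hb⟩ := hlane (ctr j c + s * k * Pl)
    (Function.update (Function.update (ctr j) i zi) c (ctr j c + s * k * Pl))
    (by rw [Function.update_of_ne (Ne.symm hci), Function.update_self]) (by rw [Function.update_self]) hzb hζI hζv
  refine ⟨t, w, hFT htF, hzw, ?_⟩
  rw [Function.update_self]
  exact hb

/-- Fatness of the level box in a direction `b ∉ {i}` where the look box does NOT stick out (inside `F`'s range) by
`2·Nbig + 2` beyond either face: from the shape of the geometry (`F`'s sides `≥ ℓ`, or `F` flat at a face of `Q ⊇ [-1,1]^d`)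
and the depth of the cube centre. [folklore] -/
theorem fat_of_not_ext (Lo Hi v : Site d) (b a : Fin d) (M Nbig L : ℕ) (ℓ : ℕ) (g : Geom d)
    (hloQ : ∀ b, g.loQ b ≤ -1) (hhiQ : ∀ b, 1 ≤ g.hiQ b)
    (hflat : g.loF a = g.loQ a ∨ g.hiF a = g.hiQ a) (hF1 : ∀ b, b ≠ a → g.loF b + 1 ≤ g.hiF b)
    (hvb : Lo b + M + 1 ≤ v b ∧ v b ≤ Hi b - M - 1)
    (hℓ : 2 * (M : ℤ) + 2 * (2 * L + 1) + 6 * Nbig + 9 ≤ ℓ) (T : ℕ) (hT : T = 2 * L + 1)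
    (hnext : ¬ ((Hi b + 2 * Nbig + 2 ≤ v b + ℓ * g.hiF b) ∨ (v b + ℓ * g.loF b + 2 * Nbig + 2 ≤ Lo b))) :
    Lo b + 2 * (M : ℤ) + 2 * T + 2 * Nbig + 4 ≤ Hi b := by
  have hℓ0 : (0 : ℤ) ≤ ℓ := Nat.cast_nonneg ℓ
  have hN0 : (0 : ℤ) ≤ Nbig := Nat.cast_nonneg Nbig
  rw [not_or, not_le, not_le] at hnext
  rw [hT]; push_cast
  by_cases hba : b = a
  · subst hba
    rcases hflat with hfl | hfl
    · have : (ℓ : ℤ) * g.loF b ≤ -ℓ := by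
        rw [hfl]; have := mul_le_mul_of_nonneg_left (hloQ b) hℓ0; linarith
      linarith [hnext.2]
    · have : (ℓ : ℤ) ≤ ℓ * g.hiF b := by
        rw [hfl]; have := mul_le_mul_of_nonneg_left (hhiQ b) hℓ0; linarith
      linarith [hnext.1]
  · have : (ℓ : ℤ) * g.loF b + ℓ ≤ ℓ * g.hiF b := by
      have := mul_le_mul_of_nonneg_left (hF1 b hba) hℓ0; linarith
    linarith [hnext.1, hnext.2]

/-- **Slab Step IV at a contact** (the hypothesis `hIV` of `stepV_in_fkLaw`, from `Π(p, L)`). For a contact window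
`(i, σ, y)` of the level box `Icc Lo Hi ⊆ D`, the gated collar `S` of width `2L+1`, and a look box `U = v + ℓQ_g ⊆ D` of a
CENTRED BOX geometry with far set in `Tgt` (`ℓ` large against the window), the free shell law gives mass `≥ 1 - 3δ` to the
patterns `ξ` for which some `u ∈ U(x)` reaches `Tgt` inside `D` with `φ_ξ`-probability `> 1 - δ`. Proof: the router —
outer lanes (`outer_lane`) when the geometry is in case O1/O23, inner lanes (`inner_lane`, gates from
`exists_gate_foot`) otherwise — feeds `slabStepIV_of_lanes`.
[cite: KozmaNitzan2024, §4 Lemma 10 Step IV (pp. 19–21); Grimmett2006, §5.7 eq. (5.102), Thm. (3.7), Thm. (3.8), eq. (3.22)] -/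
theorem slabStepIV_contact {q : ℝ} (hq : 1 ≤ q) (p : unitInterval) (hd : 3 ≤ d) {L : ℕ}
    {β : ℝ} (hβ0 : 0 ≤ β) (hβ1 : β ≤ 1)
    (hβ : ∀ (N : ℕ) (g : zdGraph d ≃g zdGraph d) (u z : Site d), u ∈ fkSlab d L N → z ∈ fkSlab d L N →
      β ≤ (fkLaw ((fkSlab d L N).image g) (restrW (↑((fkSlab d L N).image g) : Set (Site d)) (lattW d p)) q).real
        (openConnIn (↑((fkSlab d L N).image g) : Set (Site d)) (g u) (g z)))
    (Λ : Finset (Site d)) (W : Sym2 (Site d) → unitInterval) (D : Finset (Site d)) (hsub : IsSubbox W p D) (hDΛ : D ⊆ Λ)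
    (Lo Hi : Site d) (hXD : Finset.Icc Lo Hi ⊆ D) (M : ℕ) (i : Fin d) (σ : ℤ) (y : Site d) (h : WinHyp Lo Hi M i σ y)
    (hwide4 : ∀ b, Lo b + 4 * (M : ℤ) + 4 ≤ Hi b)
    (Pg Pbig N_P n n' Pl M₀ G : ℕ) (g₀ : ℤ) (hP : Pbig = 2 * N_P + 3) (hn : 0 < n) (hnPl : n * Pl ≤ N_P)
    (hPl : 2 * L + 1 ≤ Pl) (hLN_P : L ≤ N_P) (hM₀c : ((n' : ℤ) + 2) * Pbig ≤ M₀) (hPM₀ : Pbig ≤ M₀)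
    (hM : M₀ + N_P + 2 * L + 3 ≤ M) (hPg : 1 ≤ Pg) (hPgL : Pg ≤ 2 * L + 1) (hPG : Pbig ≤ G + 1) (hGM : G ≤ M₀)
    (ℓ : ℕ) (g : Geom d) (a : Fin d) (hloQ : ∀ b, g.loQ b ≤ -1) (hhiQ : ∀ b, 1 ≤ g.hiQ b)
    (hFQ : ∀ b, g.loQ b ≤ g.loF b ∧ g.hiF b ≤ g.hiQ b) (hF : ∀ b, g.loF b ≤ g.hiF b)
    (hflat : g.loF a = g.loQ a ∨ g.hiF a = g.hiQ a)
    (hF0 : ∀ b, b ≠ a → g.loF b ≤ 0 ∧ 0 ≤ g.hiF b) (hF1 : ∀ b, b ≠ a → g.loF b + 1 ≤ g.hiF b)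
    (hQD : g.Qset ℓ (vctr Lo Hi M i σ y) ⊆ D) (Tgt : Finset (Site d)) (hFT : g.Fset ℓ (vctr Lo Hi M i σ y) ⊆ Tgt)
    (Nbig mstar : ℕ) (hLN : L ≤ Nbig) (hm3 : 4 ≤ mstar)
    (hℓ : 2 * (M : ℤ) + 2 * (2 * L + 1) + 6 * Nbig + 2 * L + 9 ≤ ℓ)
    (hm : ∀ b, (ℓ : ℤ) * g.hiQ b - ℓ * g.loQ b + 2 * M + 2 ≤ (mstar : ℤ) * Nbig)
    {δ : ℝ} (hδn' : (1 - β / 2) ^ n' ≤ 3 * δ)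
    (hK : (1 - ((p : ℝ) / (p + q * (1 - p))) ^ ((2 * L + 1) + 2 * L + 5) * β ^ (d * mstar) * β ^ (d * mstar)) ^
      ⌈β * n / 2⌉₊ < δ) :
    1 - 3 * δ ≤ (fkLaw Λ (restrW (↑((Finset.Icc (Lo + 1) (Hi - 1) \ Finset.Icc (Lo + (((2 * L + 1 : ℕ) : Site d) + 1))
              (Hi - (((2 * L + 1 : ℕ) : Site d) + 1))).filter fun x => ¬ slabGate Lo Hi (2 * L + 1) Pg Pbig g₀ x) : Set (Site d)) W) q).real
      {ξ | ∃ u ∈ uface Lo Hi M i σ y, 1 - δ < (fkLaw Λ (pinW W (wireSet (↑((Finset.Icc (Lo + 1) (Hi - 1) \ Finset.Icc (Lo + (((2 * L + 1 : ℕ) : Site d) + 1))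
              (Hi - (((2 * L + 1 : ℕ) : Site d) + 1))).filter fun x => ¬ slabGate Lo Hi (2 * L + 1) Pg Pbig g₀ x) : Set (Site d))) ξ) q).real
        (⋃ t ∈ Tgt, openConnIn (↑D : Set (Site d)) u t)} := by
  have hq0 : 0 < q := one_pos.trans_le hq
  set T : ℕ := 2 * L + 1 with hT
  set v := vctr Lo Hi M i σ y with hv
  set S := ((Finset.Icc (Lo + 1) (Hi - 1) \ Finset.Icc (Lo + (((2 * L + 1 : ℕ) : Site d) + 1))
              (Hi - (((2 * L + 1 : ℕ) : Site d) + 1))).filter fun x => ¬ slabGate Lo Hi (2 * L + 1) Pg Pbig g₀ x) with hSdef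
  have hface := h.face
  have hvi : v i = y i - σ * ((M : ℤ) + 1) := by rw [hv, vctr_apply_self]
  have hvb : ∀ b, b ≠ i → Lo b + M + 1 ≤ v b ∧ v b ≤ Hi b - M - 1 := fun b hb => by
    rw [hv, vctr_apply_of_ne hb]; exact wctr_mem_of_ne h hb
  have hSsub : S ⊆ Finset.Icc (Lo + 1) (Hi - 1) := gatedCollar_subset Lo Hi T Pg Pbig g₀
  have hSint : ∀ x ∈ S, x ∉ Finset.Icc (Lo + ((T : Site d) + 1)) (Hi - ((T : Site d) + 1)) :=
    gatedCollar_not_mem_interior Lo Hi T Pg Pbig g₀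
  -- the uniform lane bound
  set γ : ℝ := ((p : ℝ) / (p + q * (1 - p))) ^ (T + 2 * L + 5) * β ^ (d * mstar) * β ^ (d * mstar) with hγ
  have hπ0 : 0 ≤ (p : ℝ) / (p + q * (1 - p)) := div_nonneg p.2.1 (by nlinarith [p.2.1, p.2.2, hq0])
  have hπ1 : (p : ℝ) / (p + q * (1 - p)) ≤ 1 := by
    rw [div_le_one (by nlinarith [p.2.1, p.2.2, hq0])]; nlinarith [p.2.1, p.2.2, hq0]
  have hγ0 : 0 ≤ γ := mul_nonneg (mul_nonneg (pow_nonneg hπ0 _) (pow_nonneg hβ0 _)) (pow_nonneg hβ0 _)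
  have hγ1 : γ ≤ 1 := mul_le_one₀ (mul_le_one₀ (pow_le_one₀ hπ0 hπ1) (pow_nonneg hβ0 _) (pow_le_one₀ hβ0 hβ1))
    (pow_nonneg hβ0 _) (pow_le_one₀ hβ0 hβ1)
  -- the side `s` in a direction `c ≠ a` on which `F` extends
  have hside : ∀ c, c ≠ a → ∃ s : ℤ, (s = 1 ∨ s = -1) ∧ ((s = 1 → 1 ≤ g.hiF c) ∧ (s = -1 → g.loF c ≤ -1)) := by
    intro c hca
    by_cases h1 : 1 ≤ g.hiF c
    · exact ⟨1, Or.inl rfl, fun _ => h1, fun h => by norm_num at h⟩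
    · refine ⟨-1, Or.inr rfl, fun h => by norm_num at h, fun _ => ?_⟩
      have := hF1 c hca; have := (hF0 c hca).2; omega
  -- layer data of the exits
  have hL0 : (0 : ℤ) ≤ L := Nat.cast_nonneg L
  have hzi1 : |y i - σ - (y i - σ * ((L : ℤ) + 1))| ≤ (L : ℤ) := by
    rcases h.sign with h1 | h1 <;> rw [h1, abs_le] <;> constructor <;> linarith
  have hziT : |y i - σ * (T : ℤ) - (y i - σ * ((L : ℤ) + 1))| ≤ (L : ℤ) := by
    rw [hT]; push_cast; rcases h.sign with h1 | h1 <;> rw [h1, abs_le] <;> constructor <;> linarith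
  -- constants for the lane lemmas
  have hM₀L : M₀ + L + T + 2 ≤ M := by omega
  have hℓlane : (M : ℤ) + 2 * T + 4 * Nbig + 2 * L + 4 ≤ ℓ := by rw [hT]; push_cast; linarith
  have hℓout : (M : ℤ) + 2 * L + 2 * Nbig + 2 ≤ ℓ := by linarith
  have hM₀ℓ : (M₀ : ℤ) + L ≤ ℓ := by
    have : (M₀ : ℤ) + N_P + 2 * L + 3 ≤ M := by exact_mod_cast hM
    linarith [Nat.cast_nonneg (α := ℤ) N_P]
  by_cases hO1 : (σ = 1 ∧ 1 ≤ g.hiF i) ∨ (σ = -1 ∧ g.loF i ≤ -1)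
  · -- case O1: outer lanes in any direction `c ∉ {i, a}`
    obtain ⟨c, hci, hca⟩ := Fin.exists_ne_and_ne_of_two_lt i a hd
    obtain ⟨s, hs, hsF⟩ := hside c hca
    refine slabStepIV_of_lanes hq p hd hβ Λ W D hsub hDΛ Lo Hi hXD M i σ y h (hwide4 i) Pg Pbig N_P n n' Pl M₀ g₀ hP
      hn hnPl hPl hLN_P hM₀c hPM₀ (by omega) ℓ hM₀ℓ g a hF0 c hci hca s hs hsF hQD Tgt hFT (y i - σ) hzi1 hγ0 hγ1 hδn'
      hK fun ζ z hzi hzc hzv hζI hζv => ?_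
    exact outer_lane hq p hd hβ0 hβ1 hβ Lo Hi i σ (y i) hface M₀ M T (by omega) v hvi hvb S hSsub ℓ g hloQ hhiQ hFQ hF
      c hci ζ ⟨by linarith [hζI.1], by linarith [hζI.2]⟩ hζv z hzi hzc hzv Nbig mstar hLN hℓout hm (Or.inl hO1)
  · by_cases hO23 : ∃ f : Fin d, f ≠ i ∧ (∃ c' : Fin d, c' ≠ i ∧ c' ≠ a ∧ c' ≠ f) ∧
        ((Hi f + 2 * Nbig + 2 ≤ v f + ℓ * g.hiF f) ∨ (v f + ℓ * g.loF f + 2 * Nbig + 2 ≤ Lo f))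
    · -- case O23: outer lanes in a direction `c ∉ {i, a, f}`
      obtain ⟨f, hfi, ⟨c, hci, hca, hcf⟩, hext⟩ := hO23
      obtain ⟨s, hs, hsF⟩ := hside c hca
      refine slabStepIV_of_lanes hq p hd hβ Λ W D hsub hDΛ Lo Hi hXD M i σ y h (hwide4 i) Pg Pbig N_P n n' Pl M₀ g₀ hP
        hn hnPl hPl hLN_P hM₀c hPM₀ (by omega) ℓ hM₀ℓ g a hF0 c hci hca s hs hsF hQD Tgt hFT (y i - σ) hzi1 hγ0 hγ1
        hδn' hK fun ζ z hzi hzc hzv hζI hζv => ?_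
      refine outer_lane hq p hd hβ0 hβ1 hβ Lo Hi i σ (y i) hface M₀ M T (by omega) v hvi hvb S hSsub ℓ g hloQ hhiQ hFQ hF
        c hci ζ ⟨by linarith [hζI.1], by linarith [hζI.2]⟩ hζv z hzi hzc hzv Nbig mstar hLN hℓout hm (Or.inr ?_)
      rcases hext with hx | hx
      · exact ⟨f, 1, Hi f, hfi, Ne.symm hcf, Or.inl ⟨rfl, rfl⟩, fun _ => by linarith, fun h => by norm_num at h⟩
      · exact ⟨f, -1, Lo f, hfi, Ne.symm hcf, Or.inr ⟨rfl, rfl⟩, fun h => by norm_num at h, fun _ => by linarith⟩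
    · -- the inner cases: direction `c ∉ {i, a}`, exits on layer `T`, gates from `exists_gate_foot`
      obtain ⟨c, hci, hca⟩ := Fin.exists_ne_and_ne_of_two_lt i a hd
      obtain ⟨s, hs, hsF⟩ := hside c hca
      have hnotO1 : (σ = 1 → g.hiF i ≤ 0) ∧ (σ = -1 → 0 ≤ g.loF i) := by
        constructor
        · intro hσ; by_contra hlt; exact hO1 (Or.inl ⟨hσ, by omega⟩)
        · intro hσ; by_contra hlt; exact hO1 (Or.inr ⟨hσ, by omega⟩)
      have hfatX : ∀ b, b ≠ c → b ≠ i → Lo b + 2 * (M : ℤ) + 2 * T + 2 * Nbig + 4 ≤ Hi b := by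
        intro b hbc hbi
        refine fat_of_not_ext Lo Hi v b a M Nbig L ℓ g hloQ hhiQ hflat hF1 (hvb b hbi) (by linarith) T hT ?_
        intro hext
        exact hO23 ⟨b, hbi, ⟨c, hci, hca, Ne.symm hbc⟩, hext⟩
      refine slabStepIV_of_lanes hq p hd hβ Λ W D hsub hDΛ Lo Hi hXD M i σ y h (hwide4 i) Pg Pbig N_P n n' Pl M₀ g₀ hP
        hn hnPl hPl hLN_P hM₀c hPM₀ (by omega) ℓ hM₀ℓ g a hF0 c hci hca s hs hsF hQD Tgt hFT (y i - σ * (T : ℤ)) hziT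
        hγ0 hγ1 hδn' hK fun ζ z hzi hzc hzv hζI hζv => ?_
      have hslabIn : Lo c + T + 1 ≤ ζ - L ∧ ζ + L ≤ Hi c - T - 1 := by
        have := hvb c hci; rw [abs_le] at hζv
        have hM' : (M₀ : ℤ) + L + T + 2 ≤ M := by exact_mod_cast hM₀L
        constructor <;> linarith [hζv.1, hζv.2]
      exact inner_lane hq p hd hβ0 hβ1 hβ Lo Hi i σ (y i) hface M₀ M T G hM₀L hGM v hvi hvb hwide4 S hSsub hSint ℓ g
        hloQ hhiQ hFQ hF a hflat hF0 hF1 c hci hca ζ hζI hζv z hzi hzc hzv Nbig mstar hLN hm3 hℓlane hm hnotO1 hfatX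
        (fun f hf τf yf hfaceF r hr => exists_gate_foot Lo Hi T Pg Pbig G L g₀ hPg hPgL (by omega) hPG f c
          (by rcases hf with h1 | h1 <;> rw [h1]; exacts [hci.symm, hca.symm]) τf yf hfaceF ζ hslabIn r hr)

end Summit.CriticalPhenomena.PercolationContinuityZ3.Theorems.FK

end
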